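import Literature.Probability.LatticeModels.KramersWannierDisorder
import Literature.Probability.LatticeModels.PlanarIsingTwoPointProofs
import Literature.Probability.LatticeModels.PlanarIsingCriticalTwoPointDecay
import HarnessLib

/-!
# Kadanoff–Ceva corner values are dominated by the critical full-plane two-point function

Topic `Literature/Probability/LatticeModels`. A priori bound for the lattice side of the programme
behind `chi_onePoint_rho` / `chi_plusTwoPoint_*` / `chi_freePlusTwoPoint_ratio` /
`chi_twoPoint_free_jordan` (Chelkak–Hongler–Izyurov, Ann. of Math. 181 (2015) = CHI15): the input of
the boundary estimate (3.13) / Lemma 3.10 in the Kadanoff–Ceva rendering of the tree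
(`IsingDisorderLaplacian.lean`: across a frozen corner `v` of a boundary plaquette `p` the primitive
jumps by `Hb(p) - Hw(v) = X_B(v, T_p)²`, `hb_sub_hw_of_frozen`), namely that these boundary jumps
are uniformly small away from the source. For the critical `+` model on a hole-free `Λ ⊆ ℤ²`, the
cut `T = crossSet W` of a dual walk `W` from the source plaquette `p₀` to `p ≠ p₀` through bonds
touching `Λ`, ANY background set `B` and ANY site `v`:

* `abs_kcCorner_le_disorder`: `|X_B(v, T)| = |⟨μ_T σ_v σ_B⟩⁺_Λ| ≤ ⟨μ_T⟩⁺_Λ` (the disorder weight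
  `μ_T = ∏_{e ∈ T} e^{-2βσ_e}` is positive and `|σ_v σ_B| = 1`);
* `disorder_eq_isingCorr_free_dual`: `⟨μ_T⟩⁺_{Λ;β} = ⟨σ_{p₀}σ_p⟩^free_{Λ*;β*}` (Kramers–Wannier,
  `KramersWannierDisorder.lean`, CHI15 eq. (2.12));
* `isingCorr_free_dual_le_twoPointPlus`: at `β = β_c = β_c*`,
  `⟨σ_{p₀}σ_p⟩^free_{Λ*;β_c} ≤ ⟨σ_0σ_{p-p₀}⟩⁺_{ℤ²;β_c}` (Griffiths II: more bonds and more volume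
  increase free correlations, and the free state is dominated by the plus state;
  `isingCorr_free_mono_graph`, `isingCorr_free_le_plusCorr`);
* **`abs_kcCorner_le_twoPointPlus`**: `|X_B(v, T)| ≤ ⟨σ_0σ_{p-p₀}⟩⁺_{ℤ²;β_c}`, and with the
  `|x|^{-1/4}` decay of the latter (`PlanarIsingCriticalTwoPointDecay.lean`, Wu + Messager–Miracle-Solé)
  **`exists_abs_kcCorner_le_rpow`**: `|X_B(v, T)| ≤ C · (max |(p-p₀)₀| |(p-p₀)₁|)^{-1/4}` with a
  universal `C` — so `X² = O((δ/dist(p, p₀))^{1/2})` at boundary plaquettes at macroscopic distance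
  from the source, uniformly in the domain.

Everything is proved; no named fact.

## References

* D. Chelkak, C. Hongler, K. Izyurov, Ann. of Math. 181 (2015) = arXiv:1202.2838, Lemma 2.6
  eq. (2.12), Prop. 3.6, eq. (3.13) — `ChelkakHonglerIzyurovAnnals2015`.
* L. P. Kadanoff, H. Ceva, Phys. Rev. B 3 (1971) 3918, §II — `KadanoffCeva1971`.
* R. B. Griffiths, J. Math. Phys. 8 (1967) 478/484 (GKS inequalities); S. Friedli, Y. Velenik,
  *Statistical Mechanics of Lattice Systems* (2017), §3.6–3.8 — `FriedliVelenik2017`.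
-/

noncomputable section

open Finset MeasureTheory SimpleGraph

namespace Literature.Probability.LatticeModels

variable {Λ : Finset (Site 2)} {β : ℝ}

/-! ### `|⟨w f⟩| ≤ ⟨w⟩` for a positive weight and a unimodular observable -/

/-- For a finite-volume Gibbs average on a countable graph: if `w > 0` and `|f| ≤ 1` pointwise
(both measurable) then `|⟨w · f⟩| ≤ ⟨w⟩`. [cite: FriedliVelenik2017, §3.1, eq. (3.8)] -/
theorem abs_isingExpect_weight_mul_le {V : Type*} [DecidableEq V] [Countable V] (G : SimpleGraph V) [G.LocallyFinite]
    (Λ : Finset V) (β h : ℝ) (bc : BoundaryCondition V) {w f : SpinConfig V → ℝ}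
    (hw : Measurable w) (hf : Measurable f) (hwpos : ∀ σ, 0 < w σ) (hf1 : ∀ σ, |f σ| ≤ 1) :
    |isingExpect G Λ β h bc (fun σ => w σ * f σ)| ≤ isingExpect G Λ β h bc w := by
  have hwf : Measurable fun σ => w σ * f σ := hw.mul hf
  rw [isingExpect_eq_sum_div G Λ h bc β hwf, isingExpect_eq_sum_div G Λ h bc β hw, abs_div,
    abs_of_pos (isingPartitionFunction_pos G Λ β h bc)]
  refine div_le_div_of_nonneg_right ?_ (isingPartitionFunction_pos G Λ β h bc).le
  calc |∑ τ : Λ → ℤˣ, isingWeight G Λ β h bc τ * (w (glue Λ τ bc) * f (glue Λ τ bc))|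
      ≤ ∑ τ : Λ → ℤˣ, |isingWeight G Λ β h bc τ * (w (glue Λ τ bc) * f (glue Λ τ bc))| :=
        Finset.abs_sum_le_sum_abs _ _
    _ ≤ ∑ τ : Λ → ℤˣ, isingWeight G Λ β h bc τ * w (glue Λ τ bc) :=
        Finset.sum_le_sum fun τ _ => by
          rw [abs_mul, abs_mul, abs_of_pos (isingWeight_pos G Λ β h bc τ), abs_of_pos (hwpos _)]
          calc isingWeight G Λ β h bc τ * (w (glue Λ τ bc) * |f (glue Λ τ bc)|)
              ≤ isingWeight G Λ β h bc τ * (w (glue Λ τ bc) * 1) := by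
                gcongr
                · exact (isingWeight_pos G Λ β h bc τ).le
                · exact (hwpos _).le
                · exact hf1 _
            _ = isingWeight G Λ β h bc τ * w (glue Λ τ bc) := by ring

/-! ### Corner values, disorders, dual spins -/

/-- **`|X_B(v, T)| ≤ ⟨μ_T⟩⁺_Λ`**: the Kadanoff–Ceva corner value is a disorder insertion tilted by
the unimodular `σ_v σ_B`. [cite: KadanoffCeva1971, §II] -/
theorem abs_kcCorner_le_disorder (Λ : Finset (Site 2)) (β : ℝ) (B : Finset (Site 2)) (T : Finset (Sym2 (Site 2)))
    (v : Site 2) :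
    |kcCorner (zdGraph 2) Λ β .plus B T v| ≤ isingExpect (zdGraph 2) Λ β 0 .plus (disorderWeight β T) :=
  abs_isingExpect_weight_mul_le (zdGraph 2) Λ β 0 .plus (measurable_disorderWeight β T)
    ((measurable_spinAt v).mul (measurable_spinProduct B)) (disorderWeight_pos β T) fun σ => by
      rw [abs_mul, abs_spinAt, abs_spinProduct, mul_one]

/-- **`⟨μ_T⟩⁺_{Λ;β} = ⟨σ_{p₀}σ_p⟩^free_{Λ*;β*}`** for the cut of a dual walk from `p₀` to `p ≠ p₀`
through bonds touching a hole-free `Λ` (Kramers–Wannier; CHI15 eq. (2.12)). [cite: ChelkakHonglerIzyurovAnnals2015, Lemma 2.6 eq. (2.12)] -/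
theorem disorder_eq_isingCorr_free_dual (hΛ : HoleFree (↑Λ : Set (Site 2))) (hβ : 0 < β)
    {p₀ p : Site 2} (W : (zdGraph 2).Walk p₀ p) (hW : crossSet W ⊆ edgesTouching (zdGraph 2) Λ) (hp : p₀ ≠ p) :
    isingExpect (zdGraph 2) Λ β 0 .plus (disorderWeight β (crossSet W)) =
      isingCorr (kwDual Λ) (dualSites Λ) (dualBeta β) 0 .free {p₀, p} := by
  rw [← kcCorner_self_eq_isingCorr_free_dual hΛ hβ W hW hp p₀, kcCorner]
  congr 1
  funext σ
  rw [spinProduct, prod_singleton, spinAt_mul_self, mul_one]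

/-- The two ends of the cut are dual sites of `Λ`. [folklore] -/
theorem pair_subset_dualSites {p₀ p : Site 2} (W : (zdGraph 2).Walk p₀ p)
    (hW : crossSet W ⊆ edgesTouching (zdGraph 2) Λ) (hp : p₀ ≠ p) :
    ({p₀, p} : Finset (Site 2)) ⊆ dualSites Λ := by
  have hmem : ∀ c, Odd (sideCount (crossSet W) c) → c ∈ dualSites Λ := fun c hc =>
    mem_dualSites_of_sideCount_ne_zero hW (Nat.pos_iff_ne_zero.1 hc.pos)
  have hpar : ∀ c, c = p₀ ∨ c = p → Odd (sideCount (crossSet W) c) := by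
    intro c hc
    rw [Nat.odd_iff, sideCount, card_plaqSide_mem_crossSet_mod_two c W]
    rcases hc with rfl | rfl
    · rw [if_pos rfl, if_neg (fun h => hp h.symm)]
    · rw [if_neg hp, if_pos rfl]
  intro c hc
  simp only [mem_insert, mem_singleton] at hc
  exact hmem c (hpar c hc)

/-- **`⟨σ_{p₀}σ_p⟩^free_{Λ*;β_c} ≤ ⟨σ_0σ_{p-p₀}⟩⁺_{ℤ²;β_c}`** for dual sites `p₀ ≠ p` of `Λ`
(Griffiths II for the graph `Λ* ≤ ℤ²` and the volume, then free `≤` plus state). [cite: FriedliVelenik2017, Exercise 3.16 and Exercise 3.25] -/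
theorem isingCorr_free_dual_le_twoPointPlus {p₀ p : Site 2} (hA : ({p₀, p} : Finset (Site 2)) ⊆ dualSites Λ)
    (hp : p₀ ≠ p) :
    isingCorr (kwDual Λ) (dualSites Λ) criticalBetaTwo 0 .free {p₀, p} ≤ twoPointPlus 2 criticalBetaTwo (p - p₀) := by
  rw [← plusCorr_pair_eq_twoPointPlus hp]
  calc isingCorr (kwDual Λ) (dualSites Λ) criticalBetaTwo 0 .free {p₀, p}
      ≤ isingCorr (zdGraph 2) (dualSites Λ) criticalBetaTwo 0 .free {p₀, p} :=
        isingCorr_free_mono_graph (fun Λ A B β h bc => GKSInequalities.gks_two_holds _) kwDual_le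
          criticalBetaTwo_pos.le le_rfl hA
    _ ≤ plusCorr 2 criticalBetaTwo 0 {p₀, p} := isingCorr_free_le_plusCorr hA

/-- **Corner values are dominated by the critical two-point function of `ℤ²`**: for the cut of a
dual walk from `p₀` to `p ≠ p₀` through bonds touching a hole-free `Λ`, any background set `B` and
any site `v`, `|X_B(v, crossSet W)| ≤ ⟨σ_0σ_{p-p₀}⟩⁺_{ℤ²;β_c}` at `β = β_c`.
[cite: ChelkakHonglerIzyurovAnnals2015, Lemma 2.6 eq. (2.12) and eq. (3.13)] -/
theorem abs_kcCorner_le_twoPointPlus (hΛ : HoleFree (↑Λ : Set (Site 2))) {p₀ p : Site 2}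
    (W : (zdGraph 2).Walk p₀ p) (hW : crossSet W ⊆ edgesTouching (zdGraph 2) Λ) (hp : p₀ ≠ p)
    (B : Finset (Site 2)) (v : Site 2) :
    |kcCorner (zdGraph 2) Λ criticalBetaTwo .plus B (crossSet W) v| ≤ twoPointPlus 2 criticalBetaTwo (p - p₀) := by
  calc |kcCorner (zdGraph 2) Λ criticalBetaTwo .plus B (crossSet W) v|
      ≤ isingExpect (zdGraph 2) Λ criticalBetaTwo 0 .plus (disorderWeight criticalBetaTwo (crossSet W)) :=
        abs_kcCorner_le_disorder Λ criticalBetaTwo B _ v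
    _ = isingCorr (kwDual Λ) (dualSites Λ) criticalBetaTwo 0 .free {p₀, p} := by
        rw [disorder_eq_isingCorr_free_dual hΛ criticalBetaTwo_pos W hW hp, dualBeta_criticalBetaTwo]
    _ ≤ twoPointPlus 2 criticalBetaTwo (p - p₀) := isingCorr_free_dual_le_twoPointPlus (pair_subset_dualSites W hW hp) hp

/-- **Power-law smallness of the corner values away from the source**: there is a universal `C > 0`
such that for every hole-free `Λ`, every cut of a dual walk from `p₀` to `p ≠ p₀` through bonds
touching `Λ`, every `B` and every `v`,
`|X_B(v, crossSet W)| ≤ C · (max |(p - p₀)₀| |(p - p₀)₁|)^{-1/4}` (critical `β`). In the scaling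
`δ → 0` this is `O((δ / |δp - δp₀|)^{1/4})`: the boundary jumps `Hb - Hw = X²` of the Kadanoff–Ceva
primitive at plaquettes at macroscopic distance from the source are `O(δ^{1/2})`, uniformly in the
domain. [cite: ChelkakHonglerIzyurovAnnals2015, eq. (3.13) (H_δ ≡ 0 on ∂Ω_δ, in the limit)] -/
theorem exists_abs_kcCorner_le_rpow :
    ∃ C : ℝ, 0 < C ∧ ∀ (Λ : Finset (Site 2)), HoleFree (↑Λ : Set (Site 2)) →
      ∀ {p₀ p : Site 2} (W : (zdGraph 2).Walk p₀ p), crossSet W ⊆ edgesTouching (zdGraph 2) Λ → p₀ ≠ p →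
        ∀ (B : Finset (Site 2)) (v : Site 2),
          |kcCorner (zdGraph 2) Λ criticalBetaTwo .plus B (crossSet W) v| ≤
            C * ((max |(p - p₀) 0| |(p - p₀) 1| : ℤ) : ℝ) ^ (-(1 / 4 : ℝ)) := by
  obtain ⟨C, hC, hle⟩ := exists_twoPointPlus_criticalBetaTwo_le_rpow
  refine ⟨C, hC, fun Λ hΛ p₀ p W hW hp B v => ?_⟩
  exact (abs_kcCorner_le_twoPointPlus hΛ W hW hp B v).trans (hle _ (sub_ne_zero.2 hp.symm))

end Literature.Probability.LatticeModels
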